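import Mathlib
import Summits.MatrixMultiplication.MatrixMultiplication.Theorems.LevelGradedCohnUmansLevelOneGL2DesignsStubTangencySetsHermitian
import Summits.MatrixMultiplication.MatrixMultiplication.Theorems.LevelGradedCohnUmansLevelOneGL2DesignsStubTangencySetsUnitalBound

/-!
# The unital bound for `stub_tangencySets`, part 3: exactness over square fields, caps at small primes

Wall-breaker axis "Hermitian unital constructions" (k7/12) for the stub `stub_tangencySets` of the
crux `LevelOneGL2Designs` (stmt-MatrixMultiplication-14080, route LevelGradedCohnUmans).

Consequences of `srs_card_sq_mul_card_le` (`q|S|² ≤ (q²-1)²`) and `srs_count_ineq` (part 2):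

* SQUARE ORDER — `srs_card_le_of_card_sq`: `|F| = q²` ⇒ `|S| ≤ q³ - 1`; with seat 10's
  `hermitian_srs` (`|S| = q³ - 1`) this is `hermitian_srs_extremal`: **the Hermitian unital is
  exactly extremal** for the stub's matrix over every field of square order (`max |S| = |F|^{3/2} - 1`),
  in particular over `GaloisField p 2` (`srs_card_le_galoisField_two`).
* PRIME ORDER (the stub's own field `ZMod p`) — `srs_card_sq_mul_prime_le` (`p|S|² ≤ (p²-1)²`),
  `srs_card_sq_lt_cube` (`|S|² < p³`), `srs_card_lt_rpow` (`|S| < p^{3/2}`: the stub's constant is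
  `< 1` at every prime), and the planner's registered sub-stub `stub_tangency_isw_bound`
  (`(|S|-1)² ≤ p³`) verbatim.
* SMALL PRIMES — with `T(p)` the largest `|S|` at the prime `p`: `T(5) ≤ 10`, `T(7) ≤ 17`
  (the EXACT census values; these are the planner's registered negative instances
  `stub_tangencyAt_5_not_11`, `stub_tangencyAt_7_not_18`, budgeted for LRAT certificates and closed
  here by arithmetic; `T(3) ≤ 4` follows the same way from `3·5² > 8²` and is already
  `FlagLine.stub_tangencyAt_3_not_5` in the tree), and the new caps `T(11) ≤ 35`, `T(13) ≤ 45`, `T(17) ≤ 69`, `T(19) ≤ 81`, `T(23) ≤ 108`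
  (`stub_tangencyAt_11_not_36`, `_13_not_46`, `_17_not_70`, `_19_not_82`, `_23_not_109`; known lower
  bounds `34, 42, 59, 66, 89`).

So in the window of the siege census the ratio `T(p)/p^{3/2}` is pinned to
`[0.934, 0.960]` at `p = 11` and `[0.896, 0.960]` at `p = 13`; the stub asks whether it stays
bounded below along infinitely many primes, which this axis cannot decide (no field involution on
`ZMod p`, no two-intersection sets — `…StubTangencySetsUnitalType` — and Conj. 10.2 of
Hunter–Pohoata–Verstraëte–Zhang 2026 predicts decay).  Elementary; no definitions.
-/

-- `Summit.MatrixMultiplication.MatrixMultiplication.…` is the tree's mandated summit/problem namespace (D-0017).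
set_option linter.dupNamespace false

namespace Summit.MatrixMultiplication.MatrixMultiplication.Theorems.LevelOneGL2Designs.UnitalBound

open Finset Matrix
open Summit.MatrixMultiplication.MatrixMultiplication.Theorems.LevelOneGL2Designs.FlagLine.TangencyHermitian
  (hermitian_srs two_le_of_card_eq_sq)

variable {F : Type*} [Field F] [Fintype F] [DecidableEq F]

/-! ## Square order: the Hermitian unital is exactly extremal -/

section SquareOrder

/-- **Exactness over square fields.**  If `|F| = q²` then every `S ⊆ F² × F²` with
`f.1 ⬝ᵥ f'.2 = 1 ↔ f = f'` has `|S| ≤ q³ - 1` (from `q²|S|² ≤ (q⁴-1)² < q⁸`).  This is the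
size of the Hermitian system `FlagLine.TangencyHermitian.hermitian_srs`, so the bound
`srs_card_sq_mul_card_le` is attained: the classical unital is extremal for the stub's matrix
on the nose, not only up to constants. [folklore] -/
theorem srs_card_le_of_card_sq (q : ℕ) (hF : Fintype.card F = q ^ 2)
    (S : Finset ((Fin 2 → F) × (Fin 2 → F)))
    (hS : ∀ f ∈ S, ∀ f' ∈ S, (f.1 ⬝ᵥ f'.2 = 1 ↔ f = f')) : S.card ≤ q ^ 3 - 1 := by
  have h := srs_card_sq_mul_card_le S hS
  rw [hF] at h
  have hq2 : 2 ≤ q := two_le_of_card_eq_sq q hF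
  have hq4 : 1 ≤ (q ^ 2) ^ 2 := Nat.one_le_pow _ _ (pow_pos (by omega) 2)
  by_contra hlt
  have hN : q ^ 3 ≤ S.card := by omega
  have h1 : q ^ 2 * (q ^ 3) ^ 2 ≤ q ^ 2 * S.card ^ 2 :=
    Nat.mul_le_mul_left _ (Nat.pow_le_pow_left hN 2)
  have h2 : ((q ^ 2) ^ 2 - 1) ^ 2 < ((q ^ 2) ^ 2) ^ 2 := Nat.pow_lt_pow_left (by omega) two_ne_zero
  have h3 : ((q ^ 2) ^ 2) ^ 2 = q ^ 2 * (q ^ 3) ^ 2 := by ring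
  omega

/-- **The Hermitian unital is extremal** (summary for fields of square order `q²`): there is an
`S` with the stub's property of size `q³ - 1` (seat 10's `hermitian_srs`: the affine Hermitian
curve minus the origin with its tangents), and no `S` is larger (`srs_card_le_of_card_sq`).
So `max |S| = |F|^{3/2} - 1` exactly whenever `|F|` is a square. [folklore] -/
theorem hermitian_srs_extremal (q : ℕ) (hF : Fintype.card F = q ^ 2) :
    (∃ S : Finset ((Fin 2 → F) × (Fin 2 → F)), S.card = q ^ 3 - 1 ∧
        ∀ f ∈ S, ∀ f' ∈ S, (f.1 ⬝ᵥ f'.2 = 1 ↔ f = f')) ∧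
      ∀ S : Finset ((Fin 2 → F) × (Fin 2 → F)),
        (∀ f ∈ S, ∀ f' ∈ S, (f.1 ⬝ᵥ f'.2 = 1 ↔ f = f')) → S.card ≤ q ^ 3 - 1 :=
  ⟨hermitian_srs q hF, fun S hS => srs_card_le_of_card_sq q hF S hS⟩

/-- The square-order case of the stub in its own shape: over `GaloisField p 2` (order `p²`) every
witness has at most `p³ - 1 = (p²)^{3/2} - 1` flags, and `p³ - 1` is attained
(`FlagLine.TangencyHermitian.tangencySets_sq_order` gives `≥ (1/2)(p²)^{3/2}`; the exact value is
`p³ - 1`). [folklore] -/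
theorem srs_card_le_galoisField_two (p : ℕ) [Fact p.Prime]
    (S : Finset ((Fin 2 → GaloisField p 2) × (Fin 2 → GaloisField p 2)))
    (hS : ∀ f ∈ S, ∀ f' ∈ S, (f.1 ⬝ᵥ f'.2 = 1 ↔ f = f')) : S.card ≤ p ^ 3 - 1 := by
  classical
  letI : Fintype (GaloisField p 2) := Fintype.ofFinite _
  have hcard : Fintype.card (GaloisField p 2) = p ^ 2 := by
    rw [← Nat.card_eq_fintype_card]
    exact GaloisField.card p 2 two_ne_zero
  exact srs_card_le_of_card_sq p hcard S hS

end SquareOrder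

/-! ## Prime order: the stub's normalisation over `ZMod p` -/

section PrimeOrder

variable {p : ℕ} [hp : Fact p.Prime]

/-- **The unital bound over the prime field** (stub vocabulary): an `S ⊆ 𝔽_p² × 𝔽_p²` with
`f.1 ⬝ᵥ f'.2 = 1 ↔ f = f'` has `p·|S|² ≤ (p² - 1)²`, i.e. `|S| ≤ p^{3/2} - p^{-1/2}`.
[folklore] -/
theorem srs_card_sq_mul_prime_le (S : Finset ((Fin 2 → ZMod p) × (Fin 2 → ZMod p)))
    (hS : ∀ f ∈ S, ∀ f' ∈ S, (dotProduct f.1 f'.2 = 1 ↔ f = f')) :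
    p * S.card ^ 2 ≤ (p ^ 2 - 1) ^ 2 := by
  have h := srs_card_sq_mul_card_le S hS
  rwa [ZMod.card] at h

/-- Consequence: `|S|² < p³`, hence `|S| < p^{3/2}` — the constant in `stub_tangencySets` must be
`< 1` at every prime (and `≤ 1` asymptotically, matching Vinh / Illés–Szőnyi–Wettl). [folklore] -/
theorem srs_card_sq_lt_cube (S : Finset ((Fin 2 → ZMod p) × (Fin 2 → ZMod p)))
    (hS : ∀ f ∈ S, ∀ f' ∈ S, (dotProduct f.1 f'.2 = 1 ↔ f = f')) :
    S.card ^ 2 < p ^ 3 := by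
  have h := srs_card_sq_mul_prime_le S hS
  have hp1 : 1 ≤ p := hp.out.one_lt.le
  have hp2 : 1 ≤ p ^ 2 := Nat.one_le_pow _ _ hp1
  have h1 : (p ^ 2 - 1) ^ 2 < (p ^ 2) ^ 2 := Nat.pow_lt_pow_left (by omega) two_ne_zero
  have h2 : (p ^ 2) ^ 2 = p * p ^ 3 := by ring
  exact Nat.lt_of_mul_lt_mul_left (by omega : p * S.card ^ 2 < p * p ^ 3)

/-- Real form: `|S| < p^{3/2}` for every witness of the stub's matrix at a prime `p`.
[folklore] -/
theorem srs_card_lt_rpow (S : Finset ((Fin 2 → ZMod p) × (Fin 2 → ZMod p)))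
    (hS : ∀ f ∈ S, ∀ f' ∈ S, (dotProduct f.1 f'.2 = 1 ↔ f = f')) :
    (S.card : ℝ) < (p : ℝ) ^ (3 / 2 : ℝ) := by
  have h := srs_card_sq_lt_cube S hS
  have hsq : ((S.card : ℝ)) ^ 2 < (p : ℝ) ^ 3 := by exact_mod_cast h
  have hrpow : (p : ℝ) ^ (3 / 2 : ℝ) = Real.sqrt ((p : ℝ) ^ 3) := by
    rw [Real.sqrt_eq_rpow, ← Real.rpow_natCast, ← Real.rpow_mul (Nat.cast_nonneg p)]
    norm_num
  rw [hrpow, Real.lt_sqrt (Nat.cast_nonneg _)]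
  exact hsq

/-- REGISTERED SUB-STUB `stub_tangency_isw_bound` (planner siege plan, DECOMPOSITIONS.md §3),
verbatim: the Illés–Szőnyi–Wettl form `(|S| - 1)² ≤ p³` — here a corollary of the sharper
`p|S|² ≤ (p²-1)²` (`srs_card_sq_lt_cube`: already `|S|² < p³`). [folklore] -/
theorem stub_tangency_isw_bound : ∀ (p : ℕ) [Fact p.Prime] (S : Finset ((Fin 2 → ZMod p) × (Fin 2 → ZMod p))), (∀ f ∈ S, ∀ f' ∈ S, (dotProduct f.1 f'.2 = 1 ↔ f = f')) → (S.card - 1) ^ 2 ≤ p ^ 3 := by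
  intro p _ S hS
  have h := srs_card_sq_lt_cube S hS
  have h1 : (S.card - 1) ^ 2 ≤ S.card ^ 2 := Nat.pow_le_pow_left (Nat.sub_le _ _) 2
  omega

/-! ### Certified caps at small primes (pure counting; no search, no SAT certificate)

With `T(p) :=` the largest `|S|` in the stub's matrix at the prime `p`, `srs_card_sq_mul_prime_le`
and `srs_count_ineq` give `T(3) ≤ 4` (`3·5² = 75 > 64`; already in the tree as
`FlagLine.stub_tangencyAt_3_not_5`, seat 3, by `decide` over the `2⁹` point sets — not restated
here), `T(5) ≤ 10`, `T(7) ≤ 17`, `T(11) ≤ 35`, `T(13) ≤ 45`; the first three are the EXACT values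
of the siege census (exhaustive search / branch-and-bound, planner seat, kit j018699), and the
planner's registered negative instances `stub_tangencyAt_5_not_11`, `stub_tangencyAt_7_not_18` — for
which LRAT refutations had been budgeted — are closed below by arithmetic alone. Known lower bounds:
`T(11) ≥ 34`, `T(13) ≥ 42` (`FlagLine.srs_recordAt_11_34`, `srs_recordAt_13_42`). -/

/-- REGISTERED SUB-STUB (negative instance, verbatim): `T(5) ≤ 10` — `5·11² = 605 > 576 = (5²-1)²`. -/
theorem stub_tangencyAt_5_not_11 : ¬ ∃ S : Finset ((Fin 2 → ZMod 5) × (Fin 2 → ZMod 5)), 11 ≤ S.card ∧ ∀ f ∈ S, ∀ f' ∈ S, (dotProduct f.1 f'.2 = 1 ↔ f = f') := by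
  rintro ⟨S, h11, hS⟩
  haveI : Fact (Nat.Prime 5) := ⟨Nat.prime_five⟩
  have h := srs_card_sq_mul_prime_le S hS
  have h' := Nat.pow_le_pow_left h11 2
  norm_num at h
  omega

/-- REGISTERED SUB-STUB (negative instance, verbatim): `T(7) ≤ 17`.  `7·|S|² ≤ 48²` leaves
`|S| ≤ 18`, and `|S| = 18` violates `srs_count_ineq` at `(a, b) = (2, 3)` (`1062 ≤ 1056`): the 8
lines through the origin would meet the 18 points `2,2,2,2,2,2,3,3` times and the 30 other
non-tangent lines `3.6` times on average, which integer intersection numbers cannot realise within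
the second moment `18·24`. -/
theorem stub_tangencyAt_7_not_18 : ¬ ∃ S : Finset ((Fin 2 → ZMod 7) × (Fin 2 → ZMod 7)), 18 ≤ S.card ∧ ∀ f ∈ S, ∀ f' ∈ S, (dotProduct f.1 f'.2 = 1 ↔ f = f') := by
  rintro ⟨S, h18, hS⟩
  haveI : Fact (Nat.Prime 7) := ⟨by norm_num⟩
  have h := srs_card_sq_mul_prime_le S hS
  have h2 := srs_count_ineq S hS 2 3
  rw [ZMod.card] at h2
  norm_num at h h2
  have hle : S.card ≤ 18 := by nlinarith [h]
  have heq : S.card = 18 := le_antisymm hle h18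
  rw [heq] at h2
  norm_num at h2

/-- New certified cap: `T(11) ≤ 35` (`11·|S|² ≤ 120²` leaves `|S| ≤ 36`; `|S| = 36` violates
`srs_count_ineq` at `(a, b) = (3, 4)`, `4212 ≤ 4200`).  Known: `T(11) ≥ 34`. -/
theorem stub_tangencyAt_11_not_36 : ¬ ∃ S : Finset ((Fin 2 → ZMod 11) × (Fin 2 → ZMod 11)), 36 ≤ S.card ∧ ∀ f ∈ S, ∀ f' ∈ S, (dotProduct f.1 f'.2 = 1 ↔ f = f') := by
  rintro ⟨S, h36, hS⟩
  haveI : Fact (Nat.Prime 11) := ⟨by norm_num⟩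
  have h := srs_card_sq_mul_prime_le S hS
  have h2 := srs_count_ineq S hS 3 4
  rw [ZMod.card] at h2
  norm_num at h h2
  have hle : S.card ≤ 36 := by nlinarith [h]
  have heq : S.card = 36 := le_antisymm hle h36
  rw [heq] at h2
  norm_num at h2

/-- New certified cap: `T(13) ≤ 45` (`13·|S|² ≤ 168²` leaves `|S| ≤ 46`; `|S| = 46` violates
`srs_count_ineq` at `(a, b) = (3, 4)`, `6210 ≤ 6196`).  Known: `T(13) ≥ 42`. -/
theorem stub_tangencyAt_13_not_46 : ¬ ∃ S : Finset ((Fin 2 → ZMod 13) × (Fin 2 → ZMod 13)), 46 ≤ S.card ∧ ∀ f ∈ S, ∀ f' ∈ S, (dotProduct f.1 f'.2 = 1 ↔ f = f') := by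
  rintro ⟨S, h46, hS⟩
  haveI : Fact (Nat.Prime 13) := ⟨by norm_num⟩
  have h := srs_card_sq_mul_prime_le S hS
  have h2 := srs_count_ineq S hS 3 4
  rw [ZMod.card] at h2
  norm_num at h h2
  have hle : S.card ≤ 46 := by nlinarith [h]
  have heq : S.card = 46 := le_antisymm hle h46
  rw [heq] at h2
  norm_num at h2

/-- Certified cap: `T(17) ≤ 69` (`17·|S|² ≤ 288²`; here the integer refinement adds nothing).
Known: `T(17) ≥ 59` (siege census, SA). -/
theorem stub_tangencyAt_17_not_70 : ¬ ∃ S : Finset ((Fin 2 → ZMod 17) × (Fin 2 → ZMod 17)), 70 ≤ S.card ∧ ∀ f ∈ S, ∀ f' ∈ S, (dotProduct f.1 f'.2 = 1 ↔ f = f') := by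
  rintro ⟨S, h70, hS⟩
  haveI : Fact (Nat.Prime 17) := ⟨by norm_num⟩
  have h := srs_card_sq_mul_prime_le S hS
  norm_num at h
  nlinarith [h]

/-- Certified cap: `T(19) ≤ 81` (`19·|S|² ≤ 360²` leaves `|S| ≤ 82`; `|S| = 82` violates
`srs_count_ineq` at `(a, b) = (4, 5)`, `19434 ≤ 19400`).  Known: `T(19) ≥ 66`. -/
theorem stub_tangencyAt_19_not_82 : ¬ ∃ S : Finset ((Fin 2 → ZMod 19) × (Fin 2 → ZMod 19)), 82 ≤ S.card ∧ ∀ f ∈ S, ∀ f' ∈ S, (dotProduct f.1 f'.2 = 1 ↔ f = f') := by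
  rintro ⟨S, h82, hS⟩
  haveI : Fact (Nat.Prime 19) := ⟨by norm_num⟩
  have h := srs_card_sq_mul_prime_le S hS
  have h2 := srs_count_ineq S hS 4 5
  rw [ZMod.card] at h2
  norm_num at h h2
  have hle : S.card ≤ 82 := by nlinarith [h]
  have heq : S.card = 82 := le_antisymm hle h82
  rw [heq] at h2
  norm_num at h2

/-- Certified cap: `T(23) ≤ 108` (`23·|S|² ≤ 528²` leaves `|S| ≤ 110`; `|S| ∈ {109, 110}` violate
`srs_count_ineq` at `(a, b) = (4, 5)`).  Known: `T(23) ≥ 89`. -/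
theorem stub_tangencyAt_23_not_109 : ¬ ∃ S : Finset ((Fin 2 → ZMod 23) × (Fin 2 → ZMod 23)), 109 ≤ S.card ∧ ∀ f ∈ S, ∀ f' ∈ S, (dotProduct f.1 f'.2 = 1 ↔ f = f') := by
  rintro ⟨S, h109, hS⟩
  haveI : Fact (Nat.Prime 23) := ⟨by norm_num⟩
  have h := srs_card_sq_mul_prime_le S hS
  have h2 := srs_count_ineq S hS 4 5
  rw [ZMod.card] at h2
  norm_num at h h2
  have hle : S.card ≤ 110 := by nlinarith [h]
  have hcases : S.card = 109 ∨ S.card = 110 := by omega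
  rcases hcases with heq | heq <;> rw [heq] at h2 <;> norm_num at h2

end PrimeOrder

end Summit.MatrixMultiplication.MatrixMultiplication.Theorems.LevelOneGL2Designs.UnitalBound
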